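import Summits.AtomisticToContinuum.Crystallization.Theorems.FluxTubeKeplerFloorGivesLayered
import Summits.AtomisticToContinuum.Crystallization.Theorems.FluxTubeKeplerFluxCellKeplerSingleScale

/-!
# F3 witness for the forward rung `CompetitorBlindRung` (periodic-competitor ladder over `FluxTubeKepler.FloorGivesLayered`)

`CompRung 0 L ρ` — FLOOR + the defect budget with NO periodic competitor un-priced (complexity `m = 0`:
no admissible cell datum has an empty-or-smaller motif, `not_isCell_zero`, so the priced set is verbatim
the budget hypothesis of `FloorGivesLayered`) force periodic windows — is the proved floor: the seed
`FluxTubeKeplerFloorGivesLayered.FloorGivesLayered_proof` (stmt-AtomisticToContinuum-15223) followed by the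
proved `FluxTubeKepler.PeriodicGivenLayered_holds`.  Self-contained copy (sub-namespace `Special`) of the
definitions of `Lines/CompetitorBlindRung.lean`, so that this file elaborates on its own; the canonical
declarations `CompetitorLadder.CompRung`, `CompetitorLadder.compRung_zero` live there with the same text.
No `sorry`.
-/

noncomputable section

namespace Summit.AtomisticToContinuum.Crystallization.Cruxes.FluxCellKepler.CompetitorLadder.Special

open Filter Topology
open Literature.MathematicalPhysics.StatisticalMechanics
open Summit.AtomisticToContinuum.Crystallization.Theorems.FluxCellKeplerSingleScale (LayeredGood)

local notation "E3" => EuclideanSpace ℝ (Fin 3)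

/-! ## Definitions -/

/-- FLOOR(P₀): `N·e(P₀) ≤ E(x)` for every Lennard-Jones ground state `x` (verbatim the first hypothesis
of `FluxTubeKepler.FloorGivesLayered`). -/
def Floor (P₀ : PeriodicConfiguration 3) : Prop :=
  ∀ (N : ℕ) (x : Fin N → E3), IsGroundState lennardJones x →
    (N : ℝ) * P₀.energyPerParticle lennardJones ≤ interactionEnergy lennardJones x

/-- The point set `F + ℤb₀ + ℤb₁ + ℤb₂` generated by a CELL DATUM `(b, F)` (cell basis `b`, motif `F`). -/
def cellSet (b : Fin 3 → E3) (F : Finset E3) : Set E3 :=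
  {p | ∃ y ∈ F, ∃ n : Fin 3 → ℤ, p = y + ∑ k, (n k : ℝ) • b k}

/-- ADMISSIBLE CELL DATA of complexity `(m, L, ρ)`: `b` linearly independent with `‖b k‖ ≤ L`, a
non-empty motif of at most `m` points of norm `≤ 3L`, pairwise inequivalent modulo `ℤb`, and the generated
point set `ρ`-separated.  (Every periodic point set with `≤ m` points per cell, a cell basis of norms `≤ L`
and separation `ρ` is `cellSet b F` for such a datum: reduce the motif into the cell.) -/
def IsCell (m : ℕ) (L ρ : ℝ) (b : Fin 3 → E3) (F : Finset E3) : Prop :=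
  LinearIndependent ℝ b ∧ (∀ k, ‖b k‖ ≤ L) ∧ F.Nonempty ∧ F.card ≤ m ∧ (∀ y ∈ F, ‖y‖ ≤ 3 * L) ∧
    (∀ y ∈ F, ∀ y' ∈ F, (∃ n : Fin 3 → ℤ, y - y' = ∑ k, (n k : ℝ) • b k) → y = y') ∧
    (∀ p ∈ cellSet b F, ∀ q ∈ cellSet b F, p ≠ q → ρ ≤ dist p q)

/-- Site `i` of `x` is `(R, η)`-PERIODIC-GOOD at complexity `(m, L, ρ)`: the relative positions
`x j − x i` are two-way `η`-matched on the `R`-ball with the point set of an admissible cell datum. -/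
def PerGood (m : ℕ) (L ρ R η : ℝ) {N : ℕ} (x : Fin N → E3) (i : Fin N) : Prop :=
  ∃ (b : Fin 3 → E3) (F : Finset E3), IsCell m L ρ b F ∧
    (∀ p ∈ cellSet b F, ‖p‖ ≤ R → ∃ j : Fin N, dist (x j - x i) p ≤ η) ∧
    (∀ j : Fin N, ‖x j - x i‖ ≤ R → ∃ p ∈ cellSet b F, dist (x j - x i) p ≤ η)

/-- COMPETITOR-BLIND BUDGET(P₀) at complexity `(m, L, ρ)`: at scale `(R, η)` only the sites that are
NEITHER layered-good NOR periodic-good are priced (the crux's quantifier order `∀ R η ∃ c`). -/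
def Budget (m : ℕ) (L ρ : ℝ) (P₀ : PeriodicConfiguration 3) : Prop :=
  ∀ R η : ℝ, 0 < R → 0 < η → ∃ c : ℝ, 0 < c ∧
    ∀ (N : ℕ) (x : Fin N → E3), IsGroundState lennardJones x →
      c * (Nat.card {i : Fin N // ¬ (LayeredGood R η x i ∨ PerGood m L ρ R η x i)} : ℝ) ≤
        interactionEnergy lennardJones x - (N : ℝ) * P₀.energyPerParticle lennardJones

/-- Periodic windows along `x` (verbatim the conclusion of `ChessboardParticlePlanes.PeriodicWindows`). -/
def HasPeriodicWindows (x : (N : ℕ) → (Fin N → E3)) : Prop :=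
  ∃ P : PeriodicConfiguration 3, ∀ R ε : ℝ, 0 < ε → ∃ᶠ N in atTop, ∃ t : E3,
    (∀ s ∈ P.points, ‖s‖ ≤ R → ∃ i : Fin N, dist (x N i + t) s ≤ ε) ∧
    (∀ i : Fin N, ‖x N i + t‖ ≤ R → ∃ s ∈ P.points, dist (x N i + t) s ≤ ε)

/-- The graded family: FLOOR + the competitor-blind budget of complexity `(m, L, ρ)` force periodic
windows along every Lennard-Jones ground-state sequence. -/
def CompRung (m : ℕ) (L ρ : ℝ) : Prop :=
  ∀ P₀ : PeriodicConfiguration 3, Floor P₀ → Budget m L ρ P₀ →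
    ∀ x : (N : ℕ) → (Fin N → E3), (∀ N, IsGroundState lennardJones (x N)) → HasPeriodicWindows x

/-- **The deciding rung** (top of the family): periodic competitors of EVERY bounded complexity go
un-priced, and Lennard-Jones ground states still have periodic windows. -/
def CompetitorBlindRung : Prop := ∀ (m : ℕ) (L ρ : ℝ), 0 < ρ → CompRung m L ρ

/-! ## Dial monotonicity -/

theorem isCell_mono {m m' : ℕ} {L L' ρ ρ' : ℝ} (hm : m ≤ m') (hL : L ≤ L') (hρ : ρ' ≤ ρ)
    {b : Fin 3 → E3} {F : Finset E3} : IsCell m L ρ b F → IsCell m' L' ρ' b F := by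
  rintro ⟨hli, hb, hne, hcard, hF, hinj, hsep⟩
  exact ⟨hli, fun k => (hb k).trans hL, hne, hcard.trans hm, fun y hy => (hF y hy).trans (by linarith),
    hinj, fun p hp q hq hpq => hρ.trans (hsep p hp q hq hpq)⟩

theorem perGood_mono {m m' : ℕ} {L L' ρ ρ' : ℝ} (hm : m ≤ m') (hL : L ≤ L') (hρ : ρ' ≤ ρ)
    {R η : ℝ} {N : ℕ} {x : Fin N → E3} {i : Fin N} :
    PerGood m L ρ R η x i → PerGood m' L' ρ' R η x i := by
  rintro ⟨b, F, hc, h₁, h₂⟩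
  exact ⟨b, F, isCell_mono hm hL hρ hc, h₁, h₂⟩

/-- A budget pricing the larger set prices the smaller one. -/
theorem budget_mono {m m' : ℕ} {L L' ρ ρ' : ℝ} (hm : m ≤ m') (hL : L ≤ L') (hρ : ρ' ≤ ρ)
    (P₀ : PeriodicConfiguration 3) : Budget m L ρ P₀ → Budget m' L' ρ' P₀ := by
  classical
  intro hB R η hR hη
  obtain ⟨c, hc, hcB⟩ := hB R η hR hη
  refine ⟨c, hc, fun N x hx => le_trans ?_ (hcB N x hx)⟩
  have hle : Nat.card {i : Fin N // ¬ (LayeredGood R η x i ∨ PerGood m' L' ρ' R η x i)} ≤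
      Nat.card {i : Fin N // ¬ (LayeredGood R η x i ∨ PerGood m L ρ R η x i)} := by
    rw [Nat.card_eq_fintype_card, Nat.card_eq_fintype_card]
    exact Fintype.card_subtype_mono _ _ fun i hi h => hi (h.imp_right (perGood_mono hm hL hρ))
  exact mul_le_mul_of_nonneg_left (by exact_mod_cast hle) hc.le

/-- `CompRung` is ANTITONE in the un-priced family: enlarging `(m, L)` or shrinking `ρ` strengthens the
rung (harder-to-easier direction of the dial). -/
theorem compRung_anti {m m' : ℕ} {L L' ρ ρ' : ℝ} (hm : m ≤ m') (hL : L ≤ L') (hρ : ρ' ≤ ρ) :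
    CompRung m' L' ρ' → CompRung m L ρ :=
  fun H P₀ hF hB x hx => H P₀ hF (budget_mono hm hL hρ P₀ hB) x hx

/-! ## F3 — the family at `m = 0` is the proved floor -/

theorem not_isCell_zero {L ρ : ℝ} {b : Fin 3 → E3} {F : Finset E3} : ¬ IsCell 0 L ρ b F := by
  rintro ⟨-, -, hne, hcard, -⟩
  have := Finset.card_pos.2 hne
  omega

theorem not_perGood_zero {L ρ R η : ℝ} {N : ℕ} (x : Fin N → E3) (i : Fin N) :
    ¬ PerGood 0 L ρ R η x i := by
  rintro ⟨b, F, hc, -⟩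
  exact not_isCell_zero hc

/-- **F3.** `CompRung 0 L ρ` — no periodic competitor un-priced — is the seed `FloorGivesLayered_proof`
followed by the proved `PeriodicGivenLayered_holds`. [folklore] -/
theorem compRung_zero (L ρ : ℝ) : CompRung 0 L ρ := by
  classical
  intro P₀ hF hB x hx
  refine Theses.FluxTubeKepler.PeriodicGivenLayered_holds x hx
    (Theorems.FluxTubeKeplerFloorGivesLayered.FloorGivesLayered_proof P₀ hF ?_ x hx)
  intro R η hR hη
  obtain ⟨c, hc, hcB⟩ := hB R η hR hη
  refine ⟨c, hc, fun N y hy => ?_⟩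
  show c * (Nat.card {i : Fin N // ¬ LayeredGood R η y i} : ℝ) ≤ _
  have hcard : Nat.card {i : Fin N // ¬ (LayeredGood R η y i ∨ PerGood 0 L ρ R η y i)} =
      Nat.card {i : Fin N // ¬ LayeredGood R η y i} :=
    Nat.card_congr (Equiv.subtypeEquivRight fun i => by simp [not_perGood_zero])
  rw [← hcard]
  exact hcB N y hy

example (L ρ : ℝ) : CompRung 0 L ρ := compRung_zero L ρ

/-- Every member above the floor gives the floor member back (the dial is antitone). -/
theorem compRung_zero_of_competitorBlindRung (h : CompetitorBlindRung) (L ρ : ℝ) (hρ : 0 < ρ) :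
    CompRung 0 L ρ :=
  compRung_anti (Nat.zero_le 1) le_rfl le_rfl (h 1 L ρ hρ)


end Summit.AtomisticToContinuum.Crystallization.Cruxes.FluxCellKepler.CompetitorLadder.Special

end
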